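import Summits.AtomisticToContinuum.BoseEinsteinCondensation.Theorems.BECCellInformationOneBodyEntropyBoundDenseCellLEB

/-!
# Crux `OneBodyEntropyBound` — line `registered`, lead's stub `stub_denseCellBound`, part 2a: tools for the
# densest-cell assembly

Support file (`--supports stmt-AtomisticToContinuum-13440`, lead c2). Elementary ingredients of the densest-cell assembly:
the `ℝ≥0∞` arithmetic that solves `β((n+1)P − γ) ≤ (n+1)δ + 27(κ+3G)(n+1)P` for `(n+1)P` (`densest_arith`, registered
as `stub_densestArith`), the passage from a uniform cell-mass bound to the coarse entropy bound
`Σ_k K⁻¹ klFun(K P_k) ≤ max(log Λ, 0) + 1` (`coarse_sum_le`), the geometry of a cell, its `7R`-margin and its `3×3×3` block,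
the isolated-point count as a sum of indicators, and the identification of the crux's Bochner cell masses with `ℝ≥0∞`
one-body masses.
-/


noncomputable section

namespace Summit.AtomisticToContinuum.BoseEinsteinCondensation.Cruxes.OneBodyEntropyBound.Birth

namespace DenseCell

open MeasureTheory Filter Topology
open scoped ENNReal NNReal
open Literature.MathematicalPhysics.QuantumManyBody.BoseGas InformationTheory
open Summit.AtomisticToContinuum.BoseEinsteinCondensation.Theorems

variable {n : ℕ} {L : ℝ}

/-! ### Arithmetic of the densest cell -/

/-- **The densest-cell inequality solved.** If `β E ≤ I ≤ δ + (κ + 3G) J`, `J ≤ 27 P`, `(N+1)P ≤ (N+1)E + γ` with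
`(N+1)δ = β`, `27κ ≤ β/4`, `81G ≤ β/4` and `P` finite, then `(N+1) P ≤ 2(1+γ)`. [folklore] -/
theorem densest_arith {β κ G γ : ℝ} {N : ℕ} {P E J I : ℝ≥0∞} (hβ : 0 < β) (hPtop : P ≠ ⊤)
    (h1 : ENNReal.ofReal β * E ≤ I)
    (h2 : I ≤ ENNReal.ofReal (β / ((N + 1 : ℕ) : ℝ)) + (ENNReal.ofReal κ + ENNReal.ofReal (3 * G)) * J)
    (h3 : J ≤ 27 * P) (h4 : ((N + 1 : ℕ) : ℝ≥0∞) * P ≤ ((N + 1 : ℕ) : ℝ≥0∞) * E + ENNReal.ofReal γ)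
    (hκ : 27 * κ ≤ β / 4) (hGβ : 81 * G ≤ β / 4) (hκ0 : 0 ≤ κ) (hG0 : 0 ≤ G) (hγ : 0 ≤ γ) :
    ((N + 1 : ℕ) : ℝ≥0∞) * P ≤ ENNReal.ofReal (2 * (1 + γ)) := by
  set X := ((N + 1 : ℕ) : ℝ≥0∞) * P with hX
  have hNpos : (0 : ℝ) < ((N + 1 : ℕ) : ℝ) := by exact_mod_cast Nat.succ_pos N
  have hXtop : X ≠ ⊤ := ENNReal.mul_ne_top (ENNReal.natCast_ne_top _) hPtop
  -- `(N+1) δ = β`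
  have hδ : ((N + 1 : ℕ) : ℝ≥0∞) * ENNReal.ofReal (β / ((N + 1 : ℕ) : ℝ)) = ENNReal.ofReal β := by
    rw [← ENNReal.ofReal_natCast, ← ENNReal.ofReal_mul (by positivity)]
    congr 1
    field_simp
  -- `27 (κ + 3G) ≤ β/2`
  have hc : (ENNReal.ofReal κ + ENNReal.ofReal (3 * G)) * 27 ≤ ENNReal.ofReal (β / 2) := by
    rw [← ENNReal.ofReal_add hκ0 (by positivity), ← ENNReal.ofReal_ofNat,
      ← ENNReal.ofReal_mul (by positivity)]
    exact ENNReal.ofReal_le_ofReal (by nlinarith)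
  -- the main chain: `β X ≤ β + (β/2) X + β γ`
  have hmain : ENNReal.ofReal β * X ≤ ENNReal.ofReal (β / 2) * X + (ENNReal.ofReal β + ENNReal.ofReal (β * γ)) :=
    calc ENNReal.ofReal β * X = ENNReal.ofReal β * (((N + 1 : ℕ) : ℝ≥0∞) * P) := rfl
      _ ≤ ENNReal.ofReal β * (((N + 1 : ℕ) : ℝ≥0∞) * E + ENNReal.ofReal γ) := by gcongr
      _ = ((N + 1 : ℕ) : ℝ≥0∞) * (ENNReal.ofReal β * E) + ENNReal.ofReal β * ENNReal.ofReal γ := by ring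
      _ ≤ ((N + 1 : ℕ) : ℝ≥0∞) * (ENNReal.ofReal (β / ((N + 1 : ℕ) : ℝ)) +
            (ENNReal.ofReal κ + ENNReal.ofReal (3 * G)) * (27 * P)) + ENNReal.ofReal β * ENNReal.ofReal γ := by
          gcongr
          exact h1.trans (h2.trans (by gcongr))
      _ = ((N + 1 : ℕ) : ℝ≥0∞) * ENNReal.ofReal (β / ((N + 1 : ℕ) : ℝ)) +
            ((ENNReal.ofReal κ + ENNReal.ofReal (3 * G)) * 27) * X + ENNReal.ofReal β * ENNReal.ofReal γ := by
          ring
      _ ≤ ENNReal.ofReal β + ENNReal.ofReal (β / 2) * X + ENNReal.ofReal (β * γ) := by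
          rw [hδ, ENNReal.ofReal_mul hβ.le]
          gcongr
      _ = ENNReal.ofReal (β / 2) * X + (ENNReal.ofReal β + ENNReal.ofReal (β * γ)) := by ring
  -- cancel `(β/2) X` (finite)
  have hsplit : ENNReal.ofReal β * X = ENNReal.ofReal (β / 2) * X + ENNReal.ofReal (β / 2) * X := by
    rw [← add_mul, ← ENNReal.ofReal_add (by positivity) (by positivity)]
    congr 2
    ring
  rw [hsplit] at hmain
  have hfin : ENNReal.ofReal (β / 2) * X ≠ ⊤ := ENNReal.mul_ne_top ENNReal.ofReal_ne_top hXtop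
  have hkey : ENNReal.ofReal (β / 2) * X ≤ ENNReal.ofReal β + ENNReal.ofReal (β * γ) :=
    (ENNReal.add_le_add_iff_left hfin).1 hmain
  -- divide by `β/2`
  have hb2 : ENNReal.ofReal (β / 2) ≠ 0 := by
    rw [ENNReal.ofReal_ne_zero_iff]; linarith
  have hrhs : ENNReal.ofReal β + ENNReal.ofReal (β * γ) = ENNReal.ofReal (β / 2) * ENNReal.ofReal (2 * (1 + γ)) := by
    rw [← ENNReal.ofReal_add hβ.le (by positivity), ← ENNReal.ofReal_mul (by positivity)]
    congr 1
    ring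
  rw [hrhs] at hkey
  exact (ENNReal.mul_le_mul_iff_right hb2 ENNReal.ofReal_ne_top).1 hkey

/-! ### From a uniform cell-mass bound to the coarse entropy bound -/

/-- `P log(K P) ≤ P · max(log Λ, 0)` when `0 ≤ P` and `K P ≤ Λ`, `0 < K`. [folklore] -/
theorem mul_log_le_mul_posPart {K Λ P : ℝ} (hK : 0 < K) (hP : 0 ≤ P) (hKP : K * P ≤ Λ) :
    P * Real.log (K * P) ≤ P * max (Real.log Λ) 0 := by
  rcases hP.eq_or_lt with h | h
  · rw [← h]; simp
  · refine mul_le_mul_of_nonneg_left ?_ hP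
    exact (Real.log_le_log (mul_pos hK h) hKP).trans (le_max_left _ _)

/-- **Coarse entropy from a sup bound.** If `0 ≤ P_k`, `Σ P_k ≤ 1` and `K P_k ≤ Λ` for all `k` (`K = #cells`), then
`Σ_k K⁻¹ klFun(K P_k) ≤ max(log Λ, 0) + 1`. [folklore] -/
theorem coarse_sum_le {ι : Type*} [Fintype ι] {K Λ : ℝ} (hK : (Fintype.card ι : ℝ) = K) (hKpos : 0 < K)
    {P : ι → ℝ} (hP0 : ∀ k, 0 ≤ P k) (hsum : ∑ k, P k ≤ 1) (hΛ : ∀ k, K * P k ≤ Λ) :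
    ∑ k, K⁻¹ * klFun (K * P k) ≤ max (Real.log Λ) 0 + 1 := by
  have hterm : ∀ k, K⁻¹ * klFun (K * P k) = P k * Real.log (K * P k) + (K⁻¹ - P k) := by
    intro k
    rw [klFun_apply]
    field_simp
    ring
  simp_rw [hterm]
  rw [Finset.sum_add_distrib, Finset.sum_sub_distrib, Finset.sum_const, Finset.card_univ, nsmul_eq_mul, hK,
    mul_inv_cancel₀ hKpos.ne']
  have h1 : ∑ k, P k * Real.log (K * P k) ≤ max (Real.log Λ) 0 :=
    calc ∑ k, P k * Real.log (K * P k) ≤ ∑ k, P k * max (Real.log Λ) 0 :=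
          Finset.sum_le_sum fun k _ => mul_log_le_mul_posPart hKpos (hP0 k) (hΛ k)
      _ = (∑ k, P k) * max (Real.log Λ) 0 := by rw [Finset.sum_mul]
      _ ≤ 1 * max (Real.log Λ) 0 := mul_le_mul_of_nonneg_right hsum (le_max_right _ _)
      _ = max (Real.log Λ) 0 := one_mul _
  have h2 : (1 : ℝ) - ∑ k, P k ≤ 1 := by linarith [Finset.sum_nonneg fun k (_ : k ∈ Finset.univ) => hP0 k]
  linarith

/-! ### Geometry of the cube, its margin and its block -/

/-- A ball of radius `7R` around a point of the half-open cube `Π[a_j, a_j + s)` lies in the closed `7R`-neighbourhood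
`Π[a_j − 7R, a_j + s + 7R]`. [folklore] -/
theorem ball_subset_margin {a : Fin 3 → ℝ} {s R : ℝ} {y : Space}
    (hy : y ∈ {y : Space | ∀ j, y j ∈ Set.Ico (a j) (a j + s)}) :
    Metric.ball y (7 * R) ⊆ {x : Space | ∀ j, x j ∈ Set.Icc (a j - 7 * R) (a j + s + 7 * R)} := by
  intro z hz j
  have hj := hy j
  rw [Metric.mem_ball] at hz
  have hcoord : |z j - y j| ≤ dist z y := by
    rw [dist_eq_norm, ← Real.norm_eq_abs]
    exact PiLp.norm_apply_le (z - y) j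
  have h := (abs_sub_lt_iff.1 (hcoord.trans_lt hz))
  constructor <;> linarith [hj.1, hj.2, h.1, h.2]

/-- The open `(7R + s/2)`-neighbourhood of the cube `Π[k₀_j s, k₀_j s + s)` lies in its `3×3×3` block once `14R ≤ s`.
[folklore] -/
theorem nbhd_subset_block {M : ℕ} (k₀ : Fin 3 → Fin M) {s R : ℝ} (hRs : 14 * R ≤ s) :
    {x : Space | ∀ j, x j ∈ Set.Ioo (((k₀ j : ℕ) : ℝ) * s - 7 * R - s / 2) (((k₀ j : ℕ) : ℝ) * s + s + 7 * R + s / 2)} ⊆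
      {y : Space | ∀ j, y j ∈ Set.Ioo (((k₀ j : ℕ) : ℝ) * s - s) (((k₀ j : ℕ) : ℝ) * s + 2 * s)} := by
  intro x hx j
  have h := hx j
  constructor <;> linarith [h.1, h.2]

/-- Rewriting a cell `Π[k_j s, (k_j+1) s)` as `Π[a_j, a_j + s)` with `a_j = k_j s`. [folklore] -/
theorem cell_eq_corner {M : ℕ} (k : Fin 3 → Fin M) (s : ℝ) :
    {y : Space | ∀ j, y j ∈ Set.Ico (((k j : ℕ) : ℝ) * s) ((((k j : ℕ) : ℝ) + 1) * s)} =
      {y : Space | ∀ j, y j ∈ Set.Ico (((k j : ℕ) : ℝ) * s) (((k j : ℕ) : ℝ) * s + s)} := by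
  ext y
  simp only [Set.mem_setOf_eq, add_mul, one_mul]

/-- The isolated-point count as a bound on a sum of indicators. [folklore] -/
theorem sum_indicator_isolated_le {N : ℕ} {a : Fin 3 → ℝ} {s R γ : ℝ}
    (hcount : ∀ X : Fin N → EuclideanSpace ℝ (Fin 3),
      ((Finset.univ.filter fun i : Fin N =>
          (∀ j, X i j ∈ Set.Ico (a j) (a j + s)) ∧
            ∀ i' : Fin N, i' ≠ i → (∀ j, X i' j ∈ Set.Ico (a j) (a j + s)) → R ≤ dist (X i) (X i')).card : ℝ) ≤ γ)
    (X : Config N) :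
    (∑ i : Fin N, ({X : Config N | X i ∈ {y : Space | ∀ j, y j ∈ Set.Ico (a j) (a j + s)} ∧
        ∀ i' : Fin N, i' ≠ i → X i' ∈ {y : Space | ∀ j, y j ∈ Set.Ico (a j) (a j + s)} → R ≤ dist (X i) (X i')}).indicator
          (fun _ => (1 : ℝ≥0∞)) X) ≤ ENNReal.ofReal γ := by
  have hc := hcount X
  set F := Finset.univ.filter fun i : Fin N =>
    (∀ j, X i j ∈ Set.Ico (a j) (a j + s)) ∧
      ∀ i' : Fin N, i' ≠ i → (∀ j, X i' j ∈ Set.Ico (a j) (a j + s)) → R ≤ dist (X i) (X i') with hF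
  have hsum : (∑ i : Fin N, ({X : Config N | X i ∈ {y : Space | ∀ j, y j ∈ Set.Ico (a j) (a j + s)} ∧
      ∀ i' : Fin N, i' ≠ i → X i' ∈ {y : Space | ∀ j, y j ∈ Set.Ico (a j) (a j + s)} → R ≤ dist (X i) (X i')}).indicator
        (fun _ => (1 : ℝ≥0∞)) X) = (F.card : ℝ≥0∞) := by
    rw [Finset.card_filter, Nat.cast_sum]
    refine Finset.sum_congr rfl fun i _ => ?_
    by_cases hi : (∀ j, X i j ∈ Set.Ico (a j) (a j + s)) ∧
        ∀ i' : Fin N, i' ≠ i → (∀ j, X i' j ∈ Set.Ico (a j) (a j + s)) → R ≤ dist (X i) (X i')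
    · rw [if_pos hi, Set.indicator_of_mem (by simpa using hi)]
      simp
    · rw [if_neg hi, Set.indicator_of_notMem (by simpa using hi)]
      simp
  rw [hsum, ← ENNReal.ofReal_natCast]
  exact ENNReal.ofReal_le_ofReal hc

/-! ### Conversions between the Bochner cell masses of the crux and `ℝ≥0∞` one-body masses -/

/-- `ofReal (1_Q(x₀) |Ψ|²) = 1_Q(x₀) ‖Ψ‖₊²`. [folklore] -/
theorem ofReal_indicator_mul_normSq (Q : Set Space) (ψ : Config (n + 1) → ℂ) (X : Config (n + 1)) :
    ENNReal.ofReal (Q.indicator (fun _ => (1 : ℝ)) (X 0) * ‖ψ X‖ ^ 2) =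
      Q.indicator (fun _ => (1 : ℝ≥0∞)) (X 0) * (‖ψ X‖₊ : ℝ≥0∞) ^ 2 := by
  by_cases hX : X 0 ∈ Q
  · rw [Set.indicator_of_mem hX, Set.indicator_of_mem hX, one_mul, one_mul, coe_nnnorm_pow_two_eq_ofReal]
  · rw [Set.indicator_of_notMem hX, Set.indicator_of_notMem hX, zero_mul, zero_mul, ENNReal.ofReal_zero]

/-- The Bochner cell mass of the one-body law equals the `ℝ≥0∞` mass of `1_Q(x₀)|Ψ|²`. [folklore] -/
theorem setIntegral_oneBody_eq_toReal (Ψ : TrialState (n + 1) L) {Q : Set Space} (hQ : MeasurableSet Q) :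
    ∫ x in Q, ∫ Y : Config n, ‖Ψ.ψ (Matrix.vecCons x Y)‖ ^ 2 =
      (∫⁻ X, Q.indicator (fun _ => (1 : ℝ≥0∞)) (X 0) * (‖Ψ.ψ X‖₊ : ℝ≥0∞) ^ 2).toReal := by
  rw [PosCore.setIntegral_oneBody_eq Ψ hQ,
    integral_eq_lintegral_of_nonneg_ae (ae_of_all _ fun X =>
      mul_nonneg (Set.indicator_nonneg (fun _ _ => zero_le_one) _) (sq_nonneg _))
      (PosCore.integrable_mul_normSq Ψ (PosCore.measurable_occ hQ 0) (C := 1)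
        (fun X => by rw [abs_le]; exact ⟨by linarith [PosCore.occ_nonneg Q X 0], PosCore.occ_le_one Q X 0⟩)).aestronglyMeasurable]
  congr 1
  exact lintegral_congr fun X => ofReal_indicator_mul_normSq Q Ψ.ψ X

/-- Arithmetic: `M³ p ≤ 16(1+γ)/(ρ l³)` from `M³ s³ = N/ρ`, `l/2 ≤ s`, `p ≤ 2(1+γ)/N`. [folklore] -/
theorem cellMass_arith {M N ρ s l γ p : ℝ} (hN : 0 < N) (hρ : 0 < ρ) (hs : 0 < s) (hl : 0 < l)
    (hM3 : M ^ 3 * s ^ 3 = N / ρ) (hls : l / 2 ≤ s) (hp : p ≤ 2 * (1 + γ) / N) (hγ : 0 ≤ γ) (hM : 0 ≤ M) :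
    M ^ 3 * p ≤ 16 * (1 + γ) / (ρ * l ^ 3) := by
  have hMeq : M ^ 3 = N / (ρ * s ^ 3) := by
    rw [eq_div_iff (by positivity)]
    rw [eq_div_iff hρ.ne'] at hM3
    linear_combination hM3
  have hs3 : (l / 2) ^ 3 ≤ s ^ 3 := pow_le_pow_left₀ (by positivity) hls 3
  calc M ^ 3 * p ≤ M ^ 3 * (2 * (1 + γ) / N) := mul_le_mul_of_nonneg_left hp (pow_nonneg hM 3)
    _ = 2 * (1 + γ) / (ρ * s ^ 3) := by rw [hMeq]; field_simp
    _ ≤ 2 * (1 + γ) / (ρ * (l / 2) ^ 3) := by gcongr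
    _ = 16 * (1 + γ) / (ρ * l ^ 3) := by field_simp; ring

/-- The Bochner cell masses of the one-body law sum to at most one. [folklore] -/
theorem sum_cellMass_le_one {M : ℕ} {s : ℝ} (hs : 0 < s) (Ψ : TrialState (n + 1) L) :
    ∑ k : Fin 3 → Fin M,
      ∫ x in {y : Space | ∀ j, y j ∈ Set.Ico (((k j : ℕ) : ℝ) * s) ((((k j : ℕ) : ℝ) + 1) * s)},
        ∫ Y : Config n, ‖Ψ.ψ (Matrix.vecCons x Y)‖ ^ 2 ≤ 1 := by
  have h := WithinCell.sum_setIntegral_marginal_le (M := M) hs Ψ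
  simpa only [TwoScaleReduction.routeCell_eq_subCell] using h

end DenseCell

/-- **Registered helper stub `stub_densestArith`** (lead, for `stub_denseCellBound`): the densest-cell inequality solved in
`ℝ≥0∞`. [folklore] -/
theorem stub_densestArith :
    ∀ (β κ G γ : ℝ) (N : ℕ) (P E J I : ENNReal), 0 < β → P ≠ ⊤ →
      ENNReal.ofReal β * E ≤ I →
      I ≤ ENNReal.ofReal (β / ((N + 1 : ℕ) : ℝ)) + (ENNReal.ofReal κ + ENNReal.ofReal (3 * G)) * J →
      J ≤ 27 * P → ((N + 1 : ℕ) : ENNReal) * P ≤ ((N + 1 : ℕ) : ENNReal) * E + ENNReal.ofReal γ →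
      27 * κ ≤ β / 4 → 81 * G ≤ β / 4 → 0 ≤ κ → 0 ≤ G → 0 ≤ γ →
      ((N + 1 : ℕ) : ENNReal) * P ≤ ENNReal.ofReal (2 * (1 + γ)) :=
  fun _ _ _ _ _ _ _ _ _ hβ hPtop h1 h2 h3 h4 hκ hGβ hκ0 hG0 hγ =>
    DenseCell.densest_arith hβ hPtop h1 h2 h3 h4 hκ hGβ hκ0 hG0 hγ

end Summit.AtomisticToContinuum.BoseEinsteinCondensation.Cruxes.OneBodyEntropyBound.Birth

end
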